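import Literature.Probability.LatticeModels.ProdBernoulliIndependence
import Literature.Probability.Percolation.PercolationProofs
import Literature.Probability.Percolation.PercolationEvents
import Summits.CriticalPhenomena.PercolationContinuityZ3.Theorems.PercNearOneGluingNoHeavyLowerTailOneLayerTwoFingerTools
import HarnessLib

/-!
# The three-point variance row `(3PT)` when `c` has at most the two neighbours `a`, `b` — every finite weighted graph

Support file for crux `stmt-CriticalPhenomena-4575` (`NoHeavyLowerTail`), seat `prim-l12-p1` gen 16 (`--supports stmt-CriticalPhenomena-4575`).
Memo `run/shared/lean/prim/prim-l12/FROM-prim-l12-p1-g16-SHARP-3PT.md` §2.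

Bond percolation `μ = prodBernoulli w` (arbitrary pair weights, finite vertex type `V`), distinct `a b c`.  The three-point variance row
`(3PT)  P(a↔b)·P(a↮b) ≤ P(a↔b, a↮c) + P(a↔c, a↮b) + P(b↔c, a↮b)` (gen 15; kernel for `n ≤ 5` in `…ThreePointVarianceLeFive`; conjectured ∀n)
is proved here on EVERY finite weighted graph in which `c` can only be joined to `a` and `b` directly (all pairs `s(c,v)`, `v ∉ {a,b,c}`, have
weight `0`; the pairs avoiding `c` are arbitrary) — e.g. the triangle on top of any `a`–`b` structure.  Proof [this work]: off a null set, with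
`R = {a ↔ b using no pair at c}` (prob. `θ'`), `A = {s(c,a) open}`, `B = {s(c,b) open}` independent: `{a↔b} = R ∪ (A∩B)` and the three cells
contain `R∩Aᶜ∩Bᶜ`, `A∩Bᶜ∩Rᶜ`, `B∩Aᶜ∩Rᶜ`; then `κT² + (1−T)²((1−r_a r_b)² − κ) ≥ 0`, `κ = (1−r_a)(1−r_b) ≤ (1−r_a r_b)²`, `T = θ'`.
Main results: `walk_to_c` (the walk lemma), `openConn_ab_iff`, `threePointVariance_twoNeighbours` (the displayed inequality).
-/

namespace Summit.CriticalPhenomena.PercolationContinuityZ3.Theorems.ThreePointVarianceTwoNeighbours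

open MeasureTheory Set
open Literature.Probability.Percolation Literature.Probability.LatticeModels

variable {V : Type*} [Fintype V] [DecidableEq V]

/-- The configuration with all pairs at `c` removed. [this work] -/
def offC (c : V) (ω : BondConfig V) : BondConfig V := ω ∩ {e | c ∉ e}

/-- `a ↔ b` without using any pair at `c`. [this work] -/
def reachOff (c a b : V) : Set (BondConfig V) := {ω | (openGraph (offC c ω)).Reachable a b}

/-- The pair `s(c,x)` is open. [this work] -/
def cOpen (c x : V) : Set (BondConfig V) := {ω | s(c, x) ∈ ω}

/-- The null event: some pair `s(c,v)`, `v ∉ {a,b,c}`, is open. [this work] -/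
def bad (a b c : V) : Set (BondConfig V) := {ω | ∃ v, v ≠ a ∧ v ≠ b ∧ v ≠ c ∧ s(c, v) ∈ ω}

/-- The pairs avoiding `c`. [this work] -/
def pairsOff (c : V) : Finset (Sym2 V) := Finset.univ.filter fun e => c ∉ e

/-- The pairs `s(c,v)`, `v ∉ {a,b,c}`. [this work] -/
def badPairs (a b c : V) : Finset (Sym2 V) := (((Finset.univ.erase a).erase b).erase c).image fun v => s(c, v)

section walks
variable {a b c : V} {ω : BondConfig V}

omit [Fintype V] [DecidableEq V] in
/-- An open pair avoiding `c` is an edge of the open graph of `offC c ω`. [this work] -/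
theorem adj_offC {u v : V} (huv : (openGraph ω).Adj u v) (hu : u ≠ c) (hv : v ≠ c) : (openGraph (offC c ω)).Adj u v := by
  rw [openGraph_adj] at huv ⊢
  refine ⟨⟨huv.1, ?_⟩, huv.2⟩
  simp only [mem_setOf_eq, Sym2.mem_iff, not_or]
  exact ⟨Ne.symm hu, Ne.symm hv⟩

omit [Fintype V] [DecidableEq V] in
/-- The open graph of `offC c ω` is a subgraph of the open graph of `ω`. [this work] -/
theorem reachable_of_offC {u v : V} (h : (openGraph (offC c ω)).Reachable u v) : (openGraph ω).Reachable u v := by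
  refine h.mono ?_
  intro x y hxy
  rw [openGraph_adj] at hxy ⊢
  exact ⟨hxy.1.1, hxy.2⟩

omit [Fintype V] in
/-- **The walk lemma**: off the null event, an open walk from `u ≠ c` to `c` passes through an open pair `s(c,x)` with `x ∈ {a,b}`,
reached from `u` without touching `c`. [this work] -/
theorem walk_to_c (hN : ω ∉ bad a b c) :
    ∀ {u v : V} (_ : (openGraph ω).Walk u v), v = c → u ≠ c →
      ∃ x, (x = a ∨ x = b) ∧ s(c, x) ∈ ω ∧ (openGraph (offC c ω)).Reachable u x := by
  intro u v p
  induction p with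
  | nil => intro hv hu; exact (hu hv).elim
  | @cons u z v' h p' ih =>
    intro hv hu
    by_cases hz : z = c
    · subst hz
      have h' := (openGraph_adj ω u z).1 h
      have hux : u = a ∨ u = b := by
        by_contra hcon
        rw [not_or] at hcon
        exact hN ⟨u, hcon.1, hcon.2, hu, by rw [Sym2.eq_swap]; exact h'.1⟩
      exact ⟨u, hux, by rw [Sym2.eq_swap]; exact h'.1, SimpleGraph.Reachable.refl u⟩
    · obtain ⟨x, hx, hcx, hr⟩ := ih hv hz
      exact ⟨x, hx, hcx, (adj_offC h hu hz).reachable.trans hr⟩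

omit [Fintype V] in
/-- Off the null event: `a ↔ b` iff `a ↔ b` avoiding the pairs at `c`, or both `s(c,a)`, `s(c,b)` are open. [this work] -/
theorem openConn_ab_iff (hab : a ≠ b) (hac : a ≠ c) (hbc : b ≠ c) (hN : ω ∉ bad a b c) :
    ω ∈ openConn a b ↔ ω ∈ reachOff c a b ∨ (s(c, a) ∈ ω ∧ s(c, b) ∈ ω) := by
  constructor
  · rintro ⟨p⟩
    -- induction along the walk, keeping the current vertex ≠ c
    have key : ∀ {u v : V} (_ : (openGraph ω).Walk u v), v = b → u ≠ c →
        (openGraph (offC c ω)).Reachable u b ∨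
          ∃ x, (x = a ∨ x = b) ∧ s(c, x) ∈ ω ∧ (openGraph (offC c ω)).Reachable u x ∧
            ∃ y, (y = a ∨ y = b) ∧ s(c, y) ∈ ω ∧ (openGraph (offC c ω)).Reachable y b := by
      intro u v q
      induction q with
      | nil => intro hv _; subst hv; exact Or.inl (SimpleGraph.Reachable.refl _)
      | @cons u z v' h q' ih =>
        intro hv hu
        by_cases hz : z = c
        · subst hz
          have h' := (openGraph_adj ω u z).1 h
          have hux : u = a ∨ u = b := by
            by_contra hcon
            rw [not_or] at hcon
            exact hN ⟨u, hcon.1, hcon.2, hu, by rw [Sym2.eq_swap]; exact h'.1⟩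
          subst hv
          obtain ⟨y, hy, hcy, hry⟩ := walk_to_c hN q'.reverse rfl hbc
          exact Or.inr ⟨u, hux, by rw [Sym2.eq_swap]; exact h'.1, SimpleGraph.Reachable.refl u, y, hy, hcy, hry.symm⟩
        · have huz : (openGraph (offC c ω)).Reachable u z := (adj_offC h hu hz).reachable
          rcases ih hv hz with hzb | ⟨x, hx, hcx, hzx, y, hy, hcy, hyb⟩
          · exact Or.inl (huz.trans hzb)
          · exact Or.inr ⟨x, hx, hcx, huz.trans hzx, y, hy, hcy, hyb⟩
    rcases key p rfl hac with h | ⟨x, hx, hcx, hax, y, hy, hcy, hyb⟩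
    · exact Or.inl h
    · rcases hx with rfl | rfl
      · rcases hy with rfl | rfl
        · exact Or.inl hyb
        · exact Or.inr ⟨hcx, hcy⟩
      · exact Or.inl hax
  · rintro (h | ⟨ha, hb⟩)
    · exact reachable_of_offC h
    · have h1 : (openGraph ω).Adj a c := (openGraph_adj ω a c).2 ⟨by rw [Sym2.eq_swap]; exact ha, hac⟩
      have h2 : (openGraph ω).Adj c b := (openGraph_adj ω c b).2 ⟨hb, Ne.symm hbc⟩
      exact h1.reachable.trans h2.reachable

omit [Fintype V] in
/-- Off the null event: `a ↔ c` implies `s(c,a)` open, or `s(c,b)` open and `a ↔ b` avoiding `c`. [this work] -/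
theorem of_openConn_ac (hac : a ≠ c) (hN : ω ∉ bad a b c) (h : ω ∈ openConn a c) :
    s(c, a) ∈ ω ∨ (s(c, b) ∈ ω ∧ ω ∈ reachOff c a b) := by
  obtain ⟨p⟩ := h
  obtain ⟨x, hx, hcx, hr⟩ := walk_to_c hN p rfl hac
  rcases hx with rfl | rfl
  · exact Or.inl hcx
  · exact Or.inr ⟨hcx, hr⟩

omit [Fintype V] in
/-- Off the null event: `b ↔ c` implies `s(c,b)` open, or `s(c,a)` open and `a ↔ b` avoiding `c`. [this work] -/
theorem of_openConn_bc (hbc : b ≠ c) (hN : ω ∉ bad a b c) (h : ω ∈ openConn b c) :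
    s(c, b) ∈ ω ∨ (s(c, a) ∈ ω ∧ ω ∈ reachOff c a b) := by
  obtain ⟨p⟩ := h
  obtain ⟨x, hx, hcx, hr⟩ := walk_to_c hN p rfl hbc
  rcases hx with rfl | rfl
  · exact Or.inr ⟨hcx, hr.symm⟩
  · exact Or.inl hcx

omit [Fintype V] in
/-- `R ∩ Aᶜ ∩ Bᶜ` (off the null event) lies in the cell `a↔b, a↮c`. [this work] -/
theorem cell_ab (hab : a ≠ b) (hac : a ≠ c) (hbc : b ≠ c) :
    reachOff c a b ∩ (cOpen c a)ᶜ ∩ (cOpen c b)ᶜ ∩ (bad a b c)ᶜ ⊆ openConn a b ∩ (openConn a c)ᶜ := by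
  rintro ω ⟨⟨⟨hR, hA⟩, hB⟩, hN⟩
  refine ⟨(openConn_ab_iff hab hac hbc hN).2 (Or.inl hR), fun h => ?_⟩
  rcases of_openConn_ac hac hN h with h1 | ⟨h2, -⟩
  · exact hA h1
  · exact hB h2

omit [Fintype V] in
/-- `A ∩ Bᶜ ∩ Rᶜ` (off the null event) lies in the cell `a↔c, a↮b`. [this work] -/
theorem cell_ac (hab : a ≠ b) (hac : a ≠ c) (hbc : b ≠ c) :
    cOpen c a ∩ (cOpen c b)ᶜ ∩ (reachOff c a b)ᶜ ∩ (bad a b c)ᶜ ⊆ openConn a c ∩ (openConn a b)ᶜ := by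
  rintro ω ⟨⟨⟨hA, hB⟩, hR⟩, hN⟩
  refine ⟨?_, fun h => ?_⟩
  · exact ((openGraph_adj ω a c).2 ⟨by rw [Sym2.eq_swap]; exact hA, hac⟩).reachable
  · rcases (openConn_ab_iff hab hac hbc hN).1 h with h1 | ⟨-, h2⟩
    · exact hR h1
    · exact hB h2

omit [Fintype V] in
/-- `B ∩ Aᶜ ∩ Rᶜ` (off the null event) lies in the cell `b↔c, a↮b`. [this work] -/
theorem cell_bc (hab : a ≠ b) (hac : a ≠ c) (hbc : b ≠ c) :
    cOpen c b ∩ (cOpen c a)ᶜ ∩ (reachOff c a b)ᶜ ∩ (bad a b c)ᶜ ⊆ openConn b c ∩ (openConn a b)ᶜ := by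
  rintro ω ⟨⟨⟨hB, hA⟩, hR⟩, hN⟩
  refine ⟨?_, fun h => ?_⟩
  · exact ((openGraph_adj ω b c).2 ⟨by rw [Sym2.eq_swap]; exact hB, hbc⟩).reachable
  · rcases (openConn_ab_iff hab hac hbc hN).1 h with h1 | ⟨h2, -⟩
    · exact hR h1
    · exact hA h2

omit [Fintype V] in
/-- `{a↔b}` agrees with `R ∪ (A ∩ B)` off the null event. [this work] -/
theorem openConn_ab_inter (hab : a ≠ b) (hac : a ≠ c) (hbc : b ≠ c) :
    openConn a b ∩ (bad a b c)ᶜ = (reachOff c a b ∪ (cOpen c a ∩ cOpen c b)) ∩ (bad a b c)ᶜ := by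
  ext ω
  simp only [mem_inter_iff, mem_compl_iff, mem_union, reachOff, cOpen, mem_setOf_eq]
  constructor
  · rintro ⟨h, hN⟩; exact ⟨(openConn_ab_iff hab hac hbc hN).1 h, hN⟩
  · rintro ⟨h, hN⟩; exact ⟨(openConn_ab_iff hab hac hbc hN).2 h, hN⟩

end walks

section det
variable (a b c : V)

/-- `s(c,x) ∉ pairsOff c`. [this work] -/
theorem mk_not_mem_pairsOff (x : V) : s(c, x) ∉ pairsOff c := by
  simp [pairsOff, Sym2.mem_iff]

/-- `reachOff` is determined by the pairs avoiding `c`. [this work] -/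
theorem determinedBy_reachOff : DeterminedBy (reachOff c a b) (↑(pairsOff c) : Set (Sym2 V)) := by
  rw [determinedBy_iff]
  intro ω ω' h
  have hoff : offC c ω = offC c ω' := by
    ext e
    simp only [offC, mem_inter_iff, mem_setOf_eq]
    constructor
    · rintro ⟨he, hc⟩
      have : e ∈ ω' ∩ ↑(pairsOff c) := by
        rw [← h]; exact ⟨he, by simp [pairsOff, hc]⟩
      exact ⟨this.1, hc⟩
    · rintro ⟨he, hc⟩
      have : e ∈ ω ∩ ↑(pairsOff c) := by
        rw [h]; exact ⟨he, by simp [pairsOff, hc]⟩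
      exact ⟨this.1, hc⟩
  simp only [reachOff, mem_setOf_eq, hoff]

omit [Fintype V] [DecidableEq V] in
/-- `cOpen c x` is determined by the coordinate `s(c,x)`. [this work] -/
theorem determinedBy_cOpen (x : V) (F : Finset (Sym2 V)) (hF : s(c, x) ∈ F) : DeterminedBy (cOpen c x) (↑F : Set (Sym2 V)) := by
  rw [determinedBy_iff]
  intro ω ω' h
  simp only [cOpen, mem_setOf_eq]
  constructor
  · intro h1
    have : s(c, x) ∈ ω' ∩ ↑F := by rw [← h]; exact ⟨h1, hF⟩
    exact this.1
  · intro h1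
    have : s(c, x) ∈ ω ∩ ↑F := by rw [h]; exact ⟨h1, hF⟩
    exact this.1

end det

section prob
variable (w : Sym2 V → unitInterval) (a b c : V)

/-- The null event has probability `0` when all pairs `s(c,v)`, `v ∉ {a,b,c}`, have weight `0`. [this work] -/
theorem real_bad (hw : ∀ v, v ≠ a → v ≠ b → v ≠ c → (w s(c, v) : ℝ) = 0) : (prodBernoulli w).real (bad a b c) = 0 := by
  have hsub : bad a b c = {ω : BondConfig V | ∃ e ∈ badPairs a b c, e ∈ ω} := by
    ext ω
    simp only [bad, badPairs, mem_setOf_eq, Finset.mem_image, Finset.mem_erase, Finset.mem_univ, and_true,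
      exists_exists_and_eq_and]
    constructor
    · rintro ⟨v, hva, hvb, hvc, hv⟩; exact ⟨v, ⟨hvc, hvb, hva⟩, hv⟩
    · rintro ⟨v, ⟨hvc, hvb, hva⟩, hv⟩; exact ⟨v, hva, hvb, hvc, hv⟩
  refine le_antisymm ?_ measureReal_nonneg
  rw [hsub]
  refine le_trans (prodBernoulli_real_exists_mem_le_sum w (badPairs a b c)) (le_of_eq ?_)
  refine Finset.sum_eq_zero fun e he => ?_
  obtain ⟨v, hv, rfl⟩ := Finset.mem_image.1 he
  simp only [Finset.mem_erase, Finset.mem_univ, and_true] at hv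
  exact hw v hv.2.2 hv.2.1 hv.1

omit [DecidableEq V] in
/-- Removing a null event does not change probabilities. [this work] -/
theorem real_inter_compl_of_null {N : Set (BondConfig V)} (hN : (prodBernoulli w).real N = 0) (X : Set (BondConfig V)) :
    (prodBernoulli w).real (X ∩ Nᶜ) = (prodBernoulli w).real X := by
  have h1 := measureReal_inter_add_sdiff (μ := prodBernoulli w) (s := X) (t := Nᶜ) MeasurableSet.of_discrete
  have h2 : (prodBernoulli w).real (X \ Nᶜ) ≤ (prodBernoulli w).real N :=
    measureReal_mono (by intro ω hω; simpa using hω.2)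
  have h3 : 0 ≤ (prodBernoulli w).real (X \ Nᶜ) := measureReal_nonneg
  linarith

/-- Independence of the `c`-free event from the two pairs at `c`: `P(X ∩ Y) = P(X) P(Y)` for `X` determined by the pairs avoiding `c` and
`Y` determined by `{s(c,a), s(c,b)}`. [this work] -/
theorem real_inter_off_pairs {X Y : Set (BondConfig V)} (hX : DeterminedBy X (↑(pairsOff c) : Set (Sym2 V)))
    (hY : DeterminedBy Y (↑({s(c, a), s(c, b)} : Finset (Sym2 V)) : Set (Sym2 V))) :
    (prodBernoulli w).real (X ∩ Y) = (prodBernoulli w).real X * (prodBernoulli w).real Y := by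
  refine prodBernoulli_real_inter_of_determinedBy_disjoint w ?_ hX hY MeasurableSet.of_discrete MeasurableSet.of_discrete
  rw [Finset.disjoint_right]
  intro e he
  simp only [Finset.mem_insert, Finset.mem_singleton] at he
  rcases he with rfl | rfl <;> exact mk_not_mem_pairsOff c _

omit [DecidableEq V] in
/-- The two pair events (or their complements) are independent: `P(A^± ∩ B^±) = P(A^±) P(B^±)` (for `a ≠ b`). [this work] -/
theorem real_cOpen_inter' (hab : a ≠ b) (sA sB : Bool) :
    (prodBernoulli w).real ((if sA then cOpen c a else (cOpen c a)ᶜ) ∩ (if sB then cOpen c b else (cOpen c b)ᶜ)) =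
      (prodBernoulli w).real (if sA then cOpen c a else (cOpen c a)ᶜ) * (prodBernoulli w).real (if sB then cOpen c b else (cOpen c b)ᶜ) := by
  have hdisj : Disjoint ({s(c, a)} : Finset (Sym2 V)) {s(c, b)} := by
    rw [Finset.disjoint_singleton_left, Finset.mem_singleton]
    intro h
    rcases Sym2.eq_iff.1 h with ⟨-, h2⟩ | ⟨h1, h2⟩
    · exact hab h2
    · exact hab (h2.symm ▸ h1 ▸ rfl)
  have hA : DeterminedBy (if sA then cOpen c a else (cOpen c a)ᶜ) (↑({s(c, a)} : Finset (Sym2 V)) : Set (Sym2 V)) := by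
    cases sA
    · exact OneLayerTwoFinger.determinedBy_compl (determinedBy_cOpen c a _ (Finset.mem_singleton_self _))
    · exact determinedBy_cOpen c a _ (Finset.mem_singleton_self _)
  have hB : DeterminedBy (if sB then cOpen c b else (cOpen c b)ᶜ) (↑({s(c, b)} : Finset (Sym2 V)) : Set (Sym2 V)) := by
    cases sB
    · exact OneLayerTwoFinger.determinedBy_compl (determinedBy_cOpen c b _ (Finset.mem_singleton_self _))
    · exact determinedBy_cOpen c b _ (Finset.mem_singleton_self _)
  exact prodBernoulli_real_inter_of_determinedBy_disjoint w hdisj hA hB MeasurableSet.of_discrete MeasurableSet.of_discrete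

end prob

/-- The real inequality behind the theorem: with `θ = T + r_a r_b − T r_a r_b`,
`θ(1−θ) ≤ T(1−r_a)(1−r_b) + (1−T)(r_a(1−r_b) + (1−r_a) r_b)` for `r_a, r_b ∈ [0,1]` (any real `T`). [this work] -/
theorem poly_ineq {T ra rb : ℝ} (hra0 : 0 ≤ ra) (hra1 : ra ≤ 1) (hrb0 : 0 ≤ rb) (hrb1 : rb ≤ 1) :
    (T + ra * rb - T * (ra * rb)) * (1 - (T + ra * rb - T * (ra * rb))) ≤
      T * ((1 - ra) * (1 - rb)) + (1 - T) * (ra * (1 - rb)) + (1 - T) * ((1 - ra) * rb) := by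
  have hκ : 0 ≤ (1 - ra) * (1 - rb) := mul_nonneg (by linarith) (by linarith)
  have hgap : (1 - ra) * (1 - rb) ≤ (1 - ra * rb) ^ 2 := by
    nlinarith [mul_nonneg hra0 hrb0, mul_nonneg (sub_nonneg.2 hra1) hrb0, mul_nonneg hra0 (sub_nonneg.2 hrb1),
      mul_nonneg (mul_nonneg hra0 hrb0) (mul_nonneg (sub_nonneg.2 hra1) (sub_nonneg.2 hrb1))]
  have hid : T * ((1 - ra) * (1 - rb)) + (1 - T) * (ra * (1 - rb)) + (1 - T) * ((1 - ra) * rb)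
      - (T + ra * rb - T * (ra * rb)) * (1 - (T + ra * rb - T * (ra * rb)))
      = (1 - ra) * (1 - rb) * T ^ 2 + (1 - T) ^ 2 * ((1 - ra * rb) ^ 2 - (1 - ra) * (1 - rb)) := by ring
  nlinarith [mul_nonneg hκ (sq_nonneg T), mul_nonneg (sq_nonneg (1 - T)) (sub_nonneg.2 hgap)]

/-- **`(3PT)` when `c` has at most the neighbours `a`, `b`, on every finite weighted graph**: if all pairs `s(c,v)`, `v ∉ {a,b,c}`, have
weight `0`, then `P(a↔b)·P(a↮b) ≤ P(a↔b, a↮c) + P(a↔c, a↮b) + P(b↔c, a↮b)`. [this work] -/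
theorem threePointVariance_twoNeighbours (w : Sym2 V → unitInterval) {a b c : V} (hab : a ≠ b) (hac : a ≠ c) (hbc : b ≠ c)
    (hw : ∀ v, v ≠ a → v ≠ b → v ≠ c → (w s(c, v) : ℝ) = 0) :
    (prodBernoulli w).real (openConn a b) * (prodBernoulli w).real (openConn a b)ᶜ ≤
      (prodBernoulli w).real (openConn a b ∩ (openConn a c)ᶜ) + (prodBernoulli w).real (openConn a c ∩ (openConn a b)ᶜ) +
        (prodBernoulli w).real (openConn b c ∩ (openConn a b)ᶜ) := by
  have hN : (prodBernoulli w).real (bad a b c) = 0 := real_bad w a b c hw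
  have hAc : (prodBernoulli w).real (cOpen c a)ᶜ = 1 - (prodBernoulli w).real (cOpen c a) :=
    probReal_compl_eq_one_sub MeasurableSet.of_discrete
  have hBc : (prodBernoulli w).real (cOpen c b)ᶜ = 1 - (prodBernoulli w).real (cOpen c b) :=
    probReal_compl_eq_one_sub MeasurableSet.of_discrete
  have hRc : (prodBernoulli w).real (reachOff c a b)ᶜ = 1 - (prodBernoulli w).real (reachOff c a b) :=
    probReal_compl_eq_one_sub MeasurableSet.of_discrete
  have hdetR : DeterminedBy (reachOff c a b) (↑(pairsOff c) : Set (Sym2 V)) := determinedBy_reachOff a b c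
  have hdetRc : DeterminedBy (reachOff c a b)ᶜ (↑(pairsOff c) : Set (Sym2 V)) := OneLayerTwoFinger.determinedBy_compl hdetR
  have hmemA : s(c, a) ∈ ({s(c, a), s(c, b)} : Finset (Sym2 V)) := by simp
  have hmemB : s(c, b) ∈ ({s(c, a), s(c, b)} : Finset (Sym2 V)) := by simp
  have hdetA := determinedBy_cOpen c a _ hmemA
  have hdetB := determinedBy_cOpen c b _ hmemB
  -- the four products of the two pair events
  have hAB : (prodBernoulli w).real (cOpen c a ∩ cOpen c b) =
      (prodBernoulli w).real (cOpen c a) * (prodBernoulli w).real (cOpen c b) := by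
    simpa using real_cOpen_inter' w a b c hab true true
  have hAcBc : (prodBernoulli w).real ((cOpen c a)ᶜ ∩ (cOpen c b)ᶜ) =
      (1 - (prodBernoulli w).real (cOpen c a)) * (1 - (prodBernoulli w).real (cOpen c b)) := by
    have h := real_cOpen_inter' w a b c hab false false
    simp only [Bool.false_eq_true, if_false] at h; rw [h, hAc, hBc]
  have hABc : (prodBernoulli w).real (cOpen c a ∩ (cOpen c b)ᶜ) =
      (prodBernoulli w).real (cOpen c a) * (1 - (prodBernoulli w).real (cOpen c b)) := by
    have h := real_cOpen_inter' w a b c hab true false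
    simp only [Bool.false_eq_true, if_false, if_true] at h; rw [h, hBc]
  have hAcB : (prodBernoulli w).real ((cOpen c a)ᶜ ∩ cOpen c b) =
      (1 - (prodBernoulli w).real (cOpen c a)) * (prodBernoulli w).real (cOpen c b) := by
    have h := real_cOpen_inter' w a b c hab false true
    simp only [Bool.false_eq_true, if_false, if_true] at h; rw [h, hAc]
  -- θ = P(a ↔ b)
  have hθ : (prodBernoulli w).real (openConn a b) = (prodBernoulli w).real (reachOff c a b) +
      (prodBernoulli w).real (cOpen c a) * (prodBernoulli w).real (cOpen c b) -
        (prodBernoulli w).real (reachOff c a b) * ((prodBernoulli w).real (cOpen c a) * (prodBernoulli w).real (cOpen c b)) := by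
    rw [← real_inter_compl_of_null w hN (openConn a b), openConn_ab_inter hab hac hbc, real_inter_compl_of_null w hN]
    have hu := measureReal_union_add_inter (μ := prodBernoulli w) (s := reachOff c a b) (t := cOpen c a ∩ cOpen c b)
      MeasurableSet.of_discrete
    have hi : (prodBernoulli w).real (reachOff c a b ∩ (cOpen c a ∩ cOpen c b)) =
        (prodBernoulli w).real (reachOff c a b) * ((prodBernoulli w).real (cOpen c a) * (prodBernoulli w).real (cOpen c b)) := by
      rw [real_inter_off_pairs w a b c hdetR (hdetA.inter hdetB), hAB]
    rw [hi, hAB] at hu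
    linarith
  have hθc : (prodBernoulli w).real (openConn a b)ᶜ = 1 - (prodBernoulli w).real (openConn a b) :=
    probReal_compl_eq_one_sub MeasurableSet.of_discrete
  -- lower bounds for the three cells
  have h1 : (prodBernoulli w).real (reachOff c a b) * ((1 - (prodBernoulli w).real (cOpen c a)) * (1 - (prodBernoulli w).real (cOpen c b)))
      ≤ (prodBernoulli w).real (openConn a b ∩ (openConn a c)ᶜ) := by
    have hprod : (prodBernoulli w).real (reachOff c a b ∩ ((cOpen c a)ᶜ ∩ (cOpen c b)ᶜ)) =
        (prodBernoulli w).real (reachOff c a b) * ((1 - (prodBernoulli w).real (cOpen c a)) * (1 - (prodBernoulli w).real (cOpen c b))) := by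
      rw [real_inter_off_pairs w a b c hdetR ((OneLayerTwoFinger.determinedBy_compl hdetA).inter (OneLayerTwoFinger.determinedBy_compl hdetB)), hAcBc]
    rw [← hprod, ← real_inter_compl_of_null w hN (reachOff c a b ∩ ((cOpen c a)ᶜ ∩ (cOpen c b)ᶜ))]
    exact measureReal_mono fun ω hω => cell_ab hab hac hbc ⟨⟨⟨hω.1.1, hω.1.2.1⟩, hω.1.2.2⟩, hω.2⟩
  have h2 : (1 - (prodBernoulli w).real (reachOff c a b)) * ((prodBernoulli w).real (cOpen c a) * (1 - (prodBernoulli w).real (cOpen c b)))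
      ≤ (prodBernoulli w).real (openConn a c ∩ (openConn a b)ᶜ) := by
    have hprod : (prodBernoulli w).real ((reachOff c a b)ᶜ ∩ (cOpen c a ∩ (cOpen c b)ᶜ)) =
        (1 - (prodBernoulli w).real (reachOff c a b)) * ((prodBernoulli w).real (cOpen c a) * (1 - (prodBernoulli w).real (cOpen c b))) := by
      rw [real_inter_off_pairs w a b c hdetRc (hdetA.inter (OneLayerTwoFinger.determinedBy_compl hdetB)), hABc, hRc]
    rw [← hprod, ← real_inter_compl_of_null w hN ((reachOff c a b)ᶜ ∩ (cOpen c a ∩ (cOpen c b)ᶜ))]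
    exact measureReal_mono fun ω hω => cell_ac hab hac hbc ⟨⟨⟨hω.1.2.1, hω.1.2.2⟩, hω.1.1⟩, hω.2⟩
  have h3 : (1 - (prodBernoulli w).real (reachOff c a b)) * ((1 - (prodBernoulli w).real (cOpen c a)) * (prodBernoulli w).real (cOpen c b))
      ≤ (prodBernoulli w).real (openConn b c ∩ (openConn a b)ᶜ) := by
    have hprod : (prodBernoulli w).real ((reachOff c a b)ᶜ ∩ ((cOpen c a)ᶜ ∩ cOpen c b)) =
        (1 - (prodBernoulli w).real (reachOff c a b)) * ((1 - (prodBernoulli w).real (cOpen c a)) * (prodBernoulli w).real (cOpen c b)) := by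
      rw [real_inter_off_pairs w a b c hdetRc ((OneLayerTwoFinger.determinedBy_compl hdetA).inter hdetB), hAcB, hRc]
    rw [← hprod, ← real_inter_compl_of_null w hN ((reachOff c a b)ᶜ ∩ ((cOpen c a)ᶜ ∩ cOpen c b))]
    exact measureReal_mono fun ω hω => cell_bc hab hac hbc ⟨⟨⟨hω.1.2.2, hω.1.2.1⟩, hω.1.1⟩, hω.2⟩
  have key := poly_ineq (T := (prodBernoulli w).real (reachOff c a b)) (ra := (prodBernoulli w).real (cOpen c a))
    (rb := (prodBernoulli w).real (cOpen c b)) measureReal_nonneg measureReal_le_one measureReal_nonneg measureReal_le_one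
  rw [hθc, hθ]
  linarith
end Summit.CriticalPhenomena.PercolationContinuityZ3.Theorems.ThreePointVarianceTwoNeighbours
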